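import Literature.Probability.LatticeModels.DiscreteRWPartitionFunction
import Literature.Probability.LatticeModels.DiscreteRectBoundaryTrace
import HarnessLib

/-!
# Separators (discrete cross-cuts) of a discrete domain: the vocabulary of CDH16 §3.2

Topic `Literature/Probability/LatticeModels` (family `crit-ising`); DEFINITIONS (no facts, nothing asserted)
for the separator surgery of the printed proof of CDH16 Thm. 1.1 (`fkIsing_topologicalRectangle_crossingBounds`,
`FKIsingTopologicalRectangleCrossing.lean`; §4.2, Lemma 4.5 and Prop. 4.6 use Thm. 3.7 / Cor. 3.8), in the
vocabulary of `DiscreteRWPartitionFunction.lean` (the completed partition function `DiscreteRect.rwZbar`,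
`DiscreteRect.rwZbarSets` on `Ω̄ = Ω ∪ ∂_ext Ω`, vertex type `Site 2 ⊕ (Site 2 × Fin 4)`).

D. Chelkak, H. Duminil-Copin, C. Hongler, EJP 21 (2016) no. 5 = arXiv:1312.7785, **§3.2 Separators** (held text
p. 9): "Given a discrete domain `Ω` with four vertices `a₁, a₂, b₁, b₂ ∈ ∂_ext Ω` listed counterclockwise and a
real parameter `k > 0`, denote `Ω_A = Ω_A^B[k] := {u ∈ Ω : Z_Ω[u;A] ≥ k Z_Ω[u;B]}`,
`Ω_B = Ω_B^A(k⁻¹) := {u ∈ Ω : Z_Ω[u;A] < k Z_Ω[u;B]}`, where `A = (a₁a₂)` and `B = (b₁b₂)`. Let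
`L_k := {xy ∈ 𝓔(Ω) : x ∈ Ω_A^B[k], y ∈ Ω_B^A(k⁻¹)}`. We call `L_k` a discrete cross-cut separating `A` and `B` in
`Ω` if both `Ω_A^B[k]` and `Ω_B^A(k⁻¹)` are nonempty and connected … The set `L_k` can be understood as a part of
`∂_ext Ω_A` as well as a part of `∂_ext Ω_B`."

* `DiscreteRect.rwZto E u A = Z_Ω[u;A]`; `DiscreteRect.sideA E A B k = Ω_A^B[k]`, `DiscreteRect.sideB E A B k =
  Ω_B^A(k⁻¹)` (finite sets of lattice vertices; `k : ℝ≥0∞`);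
* `DiscreteRect.subEdges E S` — the sub-domain spanned by a vertex set (edges of `E` inside `S`), so that
  `Ω_A`, `Ω_B` are again discrete domains presented by edge sets, with `Z_{Ω_A} = rwZbar (subEdges E Ω_A)`;
* `DiscreteRect.cutDarts E S T` — the edges of `L_k` as darts from `S` into `T`: external darts of the
  sub-domain `subEdges E S` (`isExtDart_subEdges_of_mem_cutDarts`), i.e. `L_k ⊆ ∂_ext Ω_A`; and the arc stays
  external (`IsExtDart.subEdges`);
* `DiscreteRect.IsCrossCut E A B k` — "`L_k` is a discrete cross-cut": both sides nonempty and connected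
  (as induced subgraphs of `Ω`).

With these, CDH16 Thm. 3.7 reads: `Z_{Ω_A}[A, L_k] = rwZbarSets (subEdges E (sideA E A B k)) A (inr '' cutDarts …)`
etc. API: the sides partition `verts E`, membership lemmas, sub-domains are lattice domains.

## References
* [ChelkakDuminilCopinHongler2016] D. Chelkak, H. Duminil-Copin, C. Hongler, EJP 21 (2016) no. 5, §3.2
  (separators), Thm. 3.7, Cor. 3.8; §4.2 (use).
* [Chelkak2016] D. Chelkak, Ann. Probab. 44 (2016), §5 (separators `Ω_A^B[k]`, Thm. 5.1).
-/

noncomputable section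

open scoped ENNReal
open SimpleGraph Finset

namespace Literature.Probability.LatticeModels

namespace DiscreteRect

variable {E : Finset (Sym2 (Site 2))}

/-- `Z_Ω[u; A] := Σ_{a ∈ A} Z_Ω[u, a]` for a vertex `u ∈ Ω` and a set `A ⊆ Ω̄` (typically an external arc
`A ⊆ ∂_ext Ω`), in terms of the completed partition function `rwZbar` (CDH16 §3.2: "`Ω_A^B[k] :=
{u ∈ Ω : Z_Ω[u;A] ≥ k Z_Ω[u;B]}`"). [cite: ChelkakDuminilCopinHongler2016, §3.2] -/
def rwZto (E : Finset (Sym2 (Site 2))) (u : Site 2) (A : Set (Site 2 ⊕ (Site 2 × Fin 4))) : ℝ≥0∞ :=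
  rwZbarSets E {Sum.inl u} A

open scoped Classical in
/-- **The `A`-side `Ω_A = Ω_A^B[k] := {u ∈ Ω : Z_Ω[u;A] ≥ k Z_Ω[u;B]}`** of the discrete domain `Ω = ⟨E⟩` with
respect to two sets `A, B ⊆ Ω̄` (two external arcs) and a level `k > 0`, as a finite set of lattice vertices.
[cite: ChelkakDuminilCopinHongler2016, §3.2] -/
def sideA (E : Finset (Sym2 (Site 2))) (A B : Set (Site 2 ⊕ (Site 2 × Fin 4))) (k : ℝ≥0∞) : Finset (Site 2) :=
  (verts E).filter fun u ↦ k * rwZto E u B ≤ rwZto E u A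

open scoped Classical in
/-- **The `B`-side `Ω_B = Ω_B^A(k⁻¹) := {u ∈ Ω : Z_Ω[u;A] < k Z_Ω[u;B]}`**, the complement of `Ω_A` in `Ω`.
[cite: ChelkakDuminilCopinHongler2016, §3.2] -/
def sideB (E : Finset (Sym2 (Site 2))) (A B : Set (Site 2 ⊕ (Site 2 × Fin 4))) (k : ℝ≥0∞) : Finset (Site 2) :=
  (verts E).filter fun u ↦ rwZto E u A < k * rwZto E u B

open scoped Classical in
/-- **The sub-domain of `Ω` spanned by a set of vertices**: the edges of `E` with both endpoints in `S`
(CDH16 §3.2: the pieces `Ω_A ⊃ A`, `Ω_B ⊃ B` into which a cross-cut splits `Ω`, as discrete domains).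
[cite: ChelkakDuminilCopinHongler2016, §3.2] -/
def subEdges (E : Finset (Sym2 (Site 2))) (S : Finset (Site 2)) : Finset (Sym2 (Site 2)) :=
  E.filter fun e ↦ ∀ x ∈ e, x ∈ S

open scoped Classical in
/-- **The discrete cross-cut `L_k := {xy ∈ 𝓔(Ω) : x ∈ Ω_A, y ∈ Ω_B}` seen from a side**: the darts `(x, m)`
with `x ∈ S`, `x + e_m ∈ T` and `x, x + e_m` an edge of `E` — for `S = Ω_A`, `T = Ω_B` these are the edges of
`L_k` as external darts of the sub-domain `Ω_A` ("The set `L_k` can be understood as a part of `∂_ext Ω_A`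
as well as a part of `∂_ext Ω_B`"). [cite: ChelkakDuminilCopinHongler2016, §3.2] -/
def cutDarts (E : Finset (Sym2 (Site 2))) (S T : Finset (Site 2)) : Finset (Site 2 × Fin 4) :=
  (S ×ˢ Finset.univ).filter fun d ↦ s(d.1, d.1 + dir d.2) ∈ E ∧ d.1 + dir d.2 ∈ T

/-- **`L_k` is a discrete cross-cut separating `A` and `B` in `Ω`**: both sides `Ω_A^B[k]` and
`Ω_B^A(k⁻¹)` are nonempty and connected (as induced subgraphs of `Ω`) (CDH16 §3.2: "We call `L_k` a
discrete cross-cut separating `A` and `B` in `Ω` if both `Ω_A^B[k]` and `Ω_B^A(k⁻¹)` are nonempty and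
connected"). [cite: ChelkakDuminilCopinHongler2016, §3.2] -/
def IsCrossCut (E : Finset (Sym2 (Site 2))) (A B : Set (Site 2 ⊕ (Site 2 × Fin 4))) (k : ℝ≥0∞) : Prop :=
  (sideA E A B k).Nonempty ∧ (sideB E A B k).Nonempty ∧
    ((graph E).induce {x | x.1 ∈ sideA E A B k}).Connected ∧
    ((graph E).induce {x | x.1 ∈ sideB E A B k}).Connected

/-! ### Elementary properties -/

/-- The two sides partition `Ω`: they are disjoint … [cite: ChelkakDuminilCopinHongler2016, §3.2] -/
theorem disjoint_sideA_sideB (A B : Set (Site 2 ⊕ (Site 2 × Fin 4))) (k : ℝ≥0∞) :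
    Disjoint (sideA E A B k) (sideB E A B k) := by
  classical
  rw [Finset.disjoint_left]
  intro u hA hB
  simp only [sideA, sideB, Finset.mem_filter] at hA hB
  exact absurd hA.2 (not_le.2 hB.2)

/-- … and cover it. [cite: ChelkakDuminilCopinHongler2016, §3.2] -/
theorem sideA_union_sideB (A B : Set (Site 2 ⊕ (Site 2 × Fin 4))) (k : ℝ≥0∞) :
    sideA E A B k ∪ sideB E A B k = verts E := by
  classical
  ext u
  simp only [sideA, sideB, Finset.mem_union, Finset.mem_filter]
  constructor
  · rintro (⟨h, -⟩ | ⟨h, -⟩) <;> exact h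
  · intro h
    by_cases hle : k * rwZto E u B ≤ rwZto E u A
    · exact Or.inl ⟨h, hle⟩
    · exact Or.inr ⟨h, not_le.1 hle⟩

/-- The sides lie in `Ω`. [cite: ChelkakDuminilCopinHongler2016, §3.2] -/
theorem sideA_subset (A B : Set (Site 2 ⊕ (Site 2 × Fin 4))) (k : ℝ≥0∞) : sideA E A B k ⊆ verts E := by
  classical
  exact Finset.filter_subset _ _

/-- The sides lie in `Ω`. [cite: ChelkakDuminilCopinHongler2016, §3.2] -/
theorem sideB_subset (A B : Set (Site 2 ⊕ (Site 2 × Fin 4))) (k : ℝ≥0∞) : sideB E A B k ⊆ verts E := by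
  classical
  exact Finset.filter_subset _ _

/-- A sub-domain is a sub-edge-set. [folklore] -/
theorem subEdges_subset (S : Finset (Site 2)) : subEdges E S ⊆ E := by
  classical
  exact Finset.filter_subset _ _

/-- Membership in a sub-domain. [folklore] -/
theorem mem_subEdges {S : Finset (Site 2)} {x y : Site 2} :
    s(x, y) ∈ subEdges E S ↔ s(x, y) ∈ E ∧ x ∈ S ∧ y ∈ S := by
  classical
  simp [subEdges]

/-- A sub-domain of a lattice domain is a lattice domain. [folklore] -/
theorem subEdges_subset_edgeSet (hE : ∀ e ∈ E, e ∈ (zdGraph 2).edgeSet) (S : Finset (Site 2)) :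
    ∀ e ∈ subEdges E S, e ∈ (zdGraph 2).edgeSet :=
  fun e he ↦ hE e (subEdges_subset S he)

/-- The vertices of a sub-domain lie in the spanning set. [folklore] -/
theorem verts_subEdges_subset (S : Finset (Site 2)) : verts (subEdges E S) ⊆ S := by
  classical
  intro x hx
  simp only [verts, Finset.mem_biUnion] at hx
  obtain ⟨e, he, hxe⟩ := hx
  simp only [subEdges, Finset.mem_filter] at he
  refine he.2 x ?_
  induction e using Sym2.ind with
  | h a b =>
    simp only [endpts, Sym2.lift_mk, Finset.mem_insert, Finset.mem_singleton] at hxe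
    rcases hxe with rfl | rfl
    · exact Sym2.mem_mk_left _ _
    · exact Sym2.mem_mk_right _ _

/-- Membership in the cut darts. [cite: ChelkakDuminilCopinHongler2016, §3.2] -/
theorem mem_cutDarts {S T : Finset (Site 2)} {d : Site 2 × Fin 4} :
    d ∈ cutDarts E S T ↔ d.1 ∈ S ∧ s(d.1, d.1 + dir d.2) ∈ E ∧ d.1 + dir d.2 ∈ T := by
  classical
  simp [cutDarts]

/-- **A cut edge is an external dart of its side**: if `S` and `T` are disjoint, a dart of `S` pointing along an
edge of `E` into `T` is an external dart of the sub-domain spanned by `S`, as soon as its base keeps an edge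
inside `S` ("`L_k` can be understood as a part of `∂_ext Ω_A`"). [cite: ChelkakDuminilCopinHongler2016, §3.2] -/
theorem isExtDart_subEdges_of_mem_cutDarts {S T : Finset (Site 2)} (hST : Disjoint S T) {d : Site 2 × Fin 4}
    (hd : d ∈ cutDarts E S T) (hbase : d.1 ∈ verts (subEdges E S)) : IsExtDart (subEdges E S) d := by
  refine ⟨hbase, fun hmem ↦ ?_⟩
  rw [mem_cutDarts] at hd
  rw [mem_subEdges] at hmem
  exact Finset.disjoint_left.1 hST hmem.2.2 hd.2.2

/-- External darts of `Ω` based in `S` remain external darts of the sub-domain spanned by `S` (as soon as the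
base keeps an edge inside `S`): the arcs `A ⊆ ∂_ext Ω_A`. [cite: ChelkakDuminilCopinHongler2016, §3.2] -/
theorem IsExtDart.subEdges {S : Finset (Site 2)} {d : Site 2 × Fin 4} (hd : IsExtDart E d)
    (hbase : d.1 ∈ verts (subEdges E S)) : IsExtDart (subEdges E S) d :=
  ⟨hbase, fun hmem ↦ hd.2 (subEdges_subset S hmem)⟩

/-- `Z_Ω[u;A]` unfolded. [cite: ChelkakDuminilCopinHongler2016, §3.2] -/
theorem rwZto_def (u : Site 2) (A : Set (Site 2 ⊕ (Site 2 × Fin 4))) : rwZto E u A = rwZbarSets E {Sum.inl u} A :=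
  rfl

/-- Membership in `Ω_A`. [cite: ChelkakDuminilCopinHongler2016, §3.2] -/
theorem mem_sideA {A B : Set (Site 2 ⊕ (Site 2 × Fin 4))} {k : ℝ≥0∞} {u : Site 2} :
    u ∈ sideA E A B k ↔ u ∈ verts E ∧ k * rwZto E u B ≤ rwZto E u A := by
  classical
  simp [sideA]

/-- Membership in `Ω_B`. [cite: ChelkakDuminilCopinHongler2016, §3.2] -/
theorem mem_sideB {A B : Set (Site 2 ⊕ (Site 2 × Fin 4))} {k : ℝ≥0∞} {u : Site 2} :
    u ∈ sideB E A B k ↔ u ∈ verts E ∧ rwZto E u A < k * rwZto E u B := by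
  classical
  simp [sideB]

end DiscreteRect

end Literature.Probability.LatticeModels

end
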